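import Summits.CriticalPhenomena.CardyFormulaZ2.Theses.CardySelfDualSegment
import Summits.CriticalPhenomena.CardyFormulaZ2.Theorems.CardyMagicRigidityLoopsToCrossingsStubComparisonGeometry
import Summits.CriticalPhenomena.CardyFormulaZ2.Theorems.CardyMagicRigidityLoopsToCrossingsStubCardyContinuity
import Literature.Probability.Percolation.CornerPercolation
import Literature.Probability.Percolation.CardyFormulaConformalInvariance
import Literature.Probability.Percolation.TriCrossingSandwich
import Literature.Probability.LatticeModels.TriangularLatticeProofs
import Literature.Probability.RandomPlanarGeometry.ImageUnivalent
import Literature.Probability.RandomPlanarGeometry.CollarGeometry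
import Literature.Barriers.CriticalPhenomena.EmbeddingModulusUniquenessProofs

/-!
# Crux `SmirnovBasePoint` (stmt-CriticalPhenomena-5474), line `Sketch` = sheared two-quad oracle sandwich

Skeleton of the line lead. The crux is `CardyMod 0 triZeta`: the crude `M_0` crossing
probability `cornerCrossingProb 0 R' δ` (corner percolation at `t = 0` = site percolation on `𝕋`
pushed by `upTriangleConfig`, drawn on `√2ℤ²`, event `embDomainCrossing`) of every conformal
rectangle `R'` converges to `F(η_R)` for the sheared rectangle `R = φ_ζ R'`
(`φ_ζ = moduliShear triZeta`).

Composition (`smirnovBasePoint_of`): work in the triangular frame `S = R'.map φ_ζ`, where the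
square mesh `δ` is the `𝕋`-mesh `δ' = √2 δ` (`stub_shearDictionary`: the crude event sits between
the two `𝕋`-frame crude events with slacks `δ'`, `2δ'`); squeeze between G02 `triCrossing`
events of the LOWER comparison quad `Q` of `S` (`OracleSandwich.exists_lowerQuad`; exact
inclusion `stub_lowerInclusion` from the bond realisation `stub_bondRealisation`) and of a NEW
UPPER quad `N` (`stub_upperQuad`; exact inclusion `stub_upperInclusion` from owner extraction
`stub_ownerExtraction`, boundary-contact trimming and `mem_triCrossing_of_pathIn N`); Smirnov's
theorem on `Q`, `N` and `OracleSandwich.stub_cardyContinuity` (Radó) give the limit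
(`stub_squeeze`); the uniformizing datum of `R` is one of `S` (`HasCrossingLimit.of_image_data`
with `h = id`), so the arcs of `R` are never used.
-/

noncomputable section

namespace Summit.CriticalPhenomena.CardyFormulaZ2.Cruxes.SmirnovBasePoint.ShearedSandwich

open Literature.Probability.RandomPlanarGeometry hiding cardyFunction
open Literature.Probability.Percolation hiding cardyFunction
open Literature.Probability.LatticeModels
open Literature.Barriers.CriticalPhenomena
open Summit.CriticalPhenomena.CardyFormulaZ2.Cruxes.LoopsToCrossings.OracleSandwich
open Filter Topology Set MeasureTheory Metric

/-! ## Stubs -/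

/-- **Stub A (shear dictionary).** The square-frame crude `M_0` crossing probability of `R'` at
mesh `δ` lies between the `𝕋`-frame crude probabilities of `φ_ζ R'` at `𝕋`-mesh `√2 δ` with
slacks `√2 δ` and `2 √2 δ`: `cornerPercolation_zero` (law), `φ_ζ (δ z(v)) = triMeshPoint (√2 δ) v`
(mesh), and `|w|/√2 ≤ |φ_ζ w| ≤ √(3/2) |w|` (distances). -/
theorem stub_shearDictionary : ∀ (R' : ConformalRectangle) (δ : ℝ), 0 < δ →
    (triSitePercolation half).real (upTriangleConfig ⁻¹' openCrossing
        {y : Site 2 | triMeshPoint (Real.sqrt 2 * δ) y ∈ moduliShear triZeta '' R'.carrier}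
        {u : Site 2 | infDist (triMeshPoint (Real.sqrt 2 * δ) u) (moduliShear triZeta '' R'.arc 0) ≤ Real.sqrt 2 * δ}
        {v : Site 2 | infDist (triMeshPoint (Real.sqrt 2 * δ) v) (moduliShear triZeta '' R'.arc 2) ≤ Real.sqrt 2 * δ})
      ≤ cornerCrossingProb 0 R' δ ∧
    cornerCrossingProb 0 R' δ ≤ (triSitePercolation half).real (upTriangleConfig ⁻¹' openCrossing
        {y : Site 2 | triMeshPoint (Real.sqrt 2 * δ) y ∈ moduliShear triZeta '' R'.carrier}
        {u : Site 2 | infDist (triMeshPoint (Real.sqrt 2 * δ) u) (moduliShear triZeta '' R'.arc 0) ≤ 2 * (Real.sqrt 2 * δ)}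
        {v : Site 2 | infDist (triMeshPoint (Real.sqrt 2 * δ) v) (moduliShear triZeta '' R'.arc 2) ≤ 2 * (Real.sqrt 2 * δ)}) := by
  sorry

/-- **Stub B1 (bond realisation of open-owner paths).** A `𝕋`-path of open sites inside `T` is
realised by an open bond path of `upTriangleConfig ω` whose vertices are sites of `T ∩ ω` or
apexes `x + e₀`, `x + e₁` of such sites (a diagonal step `x → x + (1,-1)` goes through the apex
`x + e₀`). -/
theorem stub_bondRealisation : ∀ (ω : SiteConfig (Site 2)) (T : Set (Site 2)) (a b : Site 2),
    PathIn triGraph (T ∩ ω) a b →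
      PathIn (openGraph (upTriangleConfig ω))
        {w : Site 2 | w ∈ T ∩ ω ∨ ∃ x ∈ T ∩ ω, w = x + ![1, 0] ∨ w = x + ![0, 1]} a b := by
  sorry

/-- **Stub B (lower exact inclusion).** Given the bond realisation (stub B1), for a comparison
quad `Q` in lower sandwich position w.r.t. `R` (the clauses of `OracleSandwich.exists_lowerQuad R`)
every G02 crossing of `Q` at small mesh `δ` is a `𝕋`-frame crude crossing of `R` with slack `δ`:
run extraction between the last bond vertex off `Ω` near `arc 0` and the first later one near
`arc 2`; the entering bond exits `Ω` through `arc 0` within `δ` of the first inside vertex. -/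
theorem stub_lowerInclusion :
    (∀ (ω : SiteConfig (Site 2)) (T : Set (Site 2)) (a b : Site 2),
      PathIn triGraph (T ∩ ω) a b →
        PathIn (openGraph (upTriangleConfig ω))
          {w : Site 2 | w ∈ T ∩ ω ∨ ∃ x ∈ T ∩ ω, w = x + ![1, 0] ∨ w = x + ![0, 1]} a b) →
    ∀ (R Q : ConformalRectangle) (r m t : ℝ), 0 < r → 0 < m → 0 < t →
      (∀ p ∈ R.arc 0, ∀ q ∈ R.arc 2, 3 * t < dist p q) →
      (∀ z ∈ cthickening r Q.carrier, z ∉ R.carrier → infDist z (R.arc 0) ≤ t ∨ infDist z (R.arc 2) ≤ t) →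
      (∀ z ∈ cthickening r Q.carrier, z ∈ R.carrier → m ≤ infDist z (R.arc 1) ∧ m ≤ infDist z (R.arc 3)) →
      (∀ z ∈ cthickening r (Q.arc 0), z ∉ R.carrier ∧ infDist z (R.arc 0) ≤ t) →
      (∀ z ∈ cthickening r (Q.arc 2), z ∉ R.carrier ∧ infDist z (R.arc 2) ≤ t) →
      ∃ δ₀ > 0, ∀ δ : ℝ, 0 < δ → δ < δ₀ →
        triCrossing Q.carrier δ (Q.arc 0) (Q.arc 2) ⊆ upTriangleConfig ⁻¹' openCrossing
          {y : Site 2 | triMeshPoint δ y ∈ R.carrier}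
          {u : Site 2 | infDist (triMeshPoint δ u) (R.arc 0) ≤ δ}
          {v : Site 2 | infDist (triMeshPoint δ v) (R.arc 2) ≤ δ} := by
  sorry

/-- **Stub C (upper comparison quad).** For every conformal rectangle `R`, closeness budget `ε₀`
and cap width `τ` there is a conformal rectangle `N` whose boundary loop and marks are `ε₀`-close
to those of `R`, whose arcs `1, 3` lie outside `Ω` at distance `≥ r` from it, which omits from
`Ω` only points within `τ` of `arc 0 ∪ arc 2`, whose points in `Ω` are `m`-far from
`arc 0 ∪ arc 2`, and whose arcs `0`, `2` are within `τ` of `arc 0`, `arc 2` (two-plateau tube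
profile: low through the corners along the arcs `0, 2`, high along the arcs `1, 3`). -/
theorem stub_upperQuad : ∀ (R : ConformalRectangle) (ε₀ τ : ℝ), 0 < ε₀ → 0 < τ →
    ∃ (N : ConformalRectangle) (r m : ℝ), 0 < r ∧ 0 < m ∧
      (∀ u : ℝ, dist (N.boundary u) (R.boundary u) ≤ ε₀) ∧
      (∀ i : Fin 4, |N.mark i - R.mark i| ≤ ε₀) ∧
      (∀ z ∈ N.arc 1 ∪ N.arc 3, ∀ w ∈ R.carrier, r ≤ dist z w) ∧
      (∀ z ∈ R.carrier, z ∉ N.carrier → infDist z (R.arc 0) ≤ τ ∨ infDist z (R.arc 2) ≤ τ) ∧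
      (∀ z ∈ N.carrier, z ∈ R.carrier → m ≤ infDist z (R.arc 0) ∧ m ≤ infDist z (R.arc 2)) ∧
      (∀ z ∈ N.arc 0, infDist z (R.arc 0) ≤ τ) ∧
      (∀ z ∈ N.arc 2, infDist z (R.arc 2) ≤ τ) := by
  sorry

/-- **Stub D1 (owner extraction).** The owners of the edges of a nontrivial open bond path of
`upTriangleConfig ω` inside `V` form a `𝕋`-path of open sites inside `V`, starting at the first
vertex or at a `𝕋`-neighbour of it and ending at the last vertex or at a `𝕋`-neighbour of it. -/
theorem stub_ownerExtraction : ∀ (ω : SiteConfig (Site 2)) (V : Set (Site 2)) (u v : Site 2),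
    PathIn (openGraph (upTriangleConfig ω)) V u v → u ≠ v →
      ∃ a b : Site 2, (a = u ∨ triGraph.Adj u a) ∧ (b = v ∨ triGraph.Adj b v) ∧
        PathIn triGraph (V ∩ ω) a b := by
  sorry

/-- **Stub D (upper exact inclusion).** Given owner extraction (stub D1), for an upper comparison
quad `N` of `R` (the clauses of stub C) every `𝕋`-frame crude crossing of `R` with slack `2δ` at
small mesh `δ` is a G02 crossing of `N`: the open-owner path (sites in `Ω`) is trimmed to a run
inside `N` entered from a cap site near `arc 0` and left to a cap site near `arc 2` (both within
`δ` of `N.arc 0`, `N.arc 2`), to which `mem_triCrossing_of_pathIn N` applies with plate margin `δ`. -/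
theorem stub_upperInclusion :
    (∀ (ω : SiteConfig (Site 2)) (V : Set (Site 2)) (u v : Site 2),
      PathIn (openGraph (upTriangleConfig ω)) V u v → u ≠ v →
        ∃ a b : Site 2, (a = u ∨ triGraph.Adj u a) ∧ (b = v ∨ triGraph.Adj b v) ∧
          PathIn triGraph (V ∩ ω) a b) →
    ∀ (R N : ConformalRectangle) (r m τ : ℝ), 0 < r → 0 < m → 0 < τ →
      (∀ p ∈ R.arc 0, ∀ q ∈ R.arc 2, 3 * τ < dist p q) →
      (∀ z ∈ N.arc 1 ∪ N.arc 3, ∀ w ∈ R.carrier, r ≤ dist z w) →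
      (∀ z ∈ R.carrier, z ∉ N.carrier → infDist z (R.arc 0) ≤ τ ∨ infDist z (R.arc 2) ≤ τ) →
      (∀ z ∈ N.carrier, z ∈ R.carrier → m ≤ infDist z (R.arc 0) ∧ m ≤ infDist z (R.arc 2)) →
      (∀ z ∈ N.arc 0, infDist z (R.arc 0) ≤ τ) →
      (∀ z ∈ N.arc 2, infDist z (R.arc 2) ≤ τ) →
      ∃ δ₀ > 0, ∀ δ : ℝ, 0 < δ → δ < δ₀ →
        upTriangleConfig ⁻¹' openCrossing
          {y : Site 2 | triMeshPoint δ y ∈ R.carrier}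
          {u : Site 2 | infDist (triMeshPoint δ u) (R.arc 0) ≤ 2 * δ}
          {v : Site 2 | infDist (triMeshPoint δ v) (R.arc 2) ≤ 2 * δ} ⊆
        triCrossing N.carrier δ (N.arc 0) (N.arc 2) := by
  sorry

/-- **Stub E1 (the squeeze).** Given the upper-quad provider (stub C): if a family `pr` dominates,
for small mesh, the G02 crossing probability of every comparison quad in lower sandwich position
and is dominated by that of every upper comparison quad, then `pr δ → F(η_R)`: Smirnov's theorem
on the quads (`hasCrossingLimit_triDomainCrossingProb_holds`), `OracleSandwich.exists_lowerQuad`,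
and `OracleSandwich.stub_cardyContinuity` (Radó) for the room, as in `crudeToCanonical_proof`. -/
theorem stub_squeeze :
    (∀ (R : ConformalRectangle) (ε₀ τ : ℝ), 0 < ε₀ → 0 < τ →
      ∃ (N : ConformalRectangle) (r m : ℝ), 0 < r ∧ 0 < m ∧
        (∀ u : ℝ, dist (N.boundary u) (R.boundary u) ≤ ε₀) ∧
        (∀ i : Fin 4, |N.mark i - R.mark i| ≤ ε₀) ∧
        (∀ z ∈ N.arc 1 ∪ N.arc 3, ∀ w ∈ R.carrier, r ≤ dist z w) ∧
        (∀ z ∈ R.carrier, z ∉ N.carrier → infDist z (R.arc 0) ≤ τ ∨ infDist z (R.arc 2) ≤ τ) ∧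
        (∀ z ∈ N.carrier, z ∈ R.carrier → m ≤ infDist z (R.arc 0) ∧ m ≤ infDist z (R.arc 2)) ∧
        (∀ z ∈ N.arc 0, infDist z (R.arc 0) ≤ τ) ∧
        (∀ z ∈ N.arc 2, infDist z (R.arc 2) ≤ τ)) →
    ∀ (R : ConformalRectangle) (pr : ℝ → ℝ),
      (∀ (Q : ConformalRectangle) (r m t : ℝ), 0 < r → 0 < m → 0 < t →
        (∀ p ∈ R.arc 0, ∀ q ∈ R.arc 2, 3 * t < dist p q) →
        (∀ z ∈ cthickening r Q.carrier, z ∉ R.carrier → infDist z (R.arc 0) ≤ t ∨ infDist z (R.arc 2) ≤ t) →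
        (∀ z ∈ cthickening r Q.carrier, z ∈ R.carrier → m ≤ infDist z (R.arc 1) ∧ m ≤ infDist z (R.arc 3)) →
        (∀ z ∈ cthickening r (Q.arc 0), z ∉ R.carrier ∧ infDist z (R.arc 0) ≤ t) →
        (∀ z ∈ cthickening r (Q.arc 2), z ∉ R.carrier ∧ infDist z (R.arc 2) ≤ t) →
        ∃ δ₀ > 0, ∀ δ : ℝ, 0 < δ → δ < δ₀ → triDomainCrossingProb Q δ ≤ pr δ) →
      (∀ (N : ConformalRectangle) (r m τ : ℝ), 0 < r → 0 < m → 0 < τ →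
        (∀ p ∈ R.arc 0, ∀ q ∈ R.arc 2, 3 * τ < dist p q) →
        (∀ z ∈ N.arc 1 ∪ N.arc 3, ∀ w ∈ R.carrier, r ≤ dist z w) →
        (∀ z ∈ R.carrier, z ∉ N.carrier → infDist z (R.arc 0) ≤ τ ∨ infDist z (R.arc 2) ≤ τ) →
        (∀ z ∈ N.carrier, z ∈ R.carrier → m ≤ infDist z (R.arc 0) ∧ m ≤ infDist z (R.arc 2)) →
        (∀ z ∈ N.arc 0, infDist z (R.arc 0) ≤ τ) →
        (∀ z ∈ N.arc 2, infDist z (R.arc 2) ≤ τ) →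
        ∃ δ₀ > 0, ∀ δ : ℝ, 0 < δ → δ < δ₀ → pr δ ≤ triDomainCrossingProb N δ) →
      R.HasCrossingLimit pr Literature.Probability.RandomPlanarGeometry.cardyFunction := by
  sorry

/-! ## Composition -/

/-- `Im ζ = √3/2 ≠ 0`. [folklore] -/
theorem triZeta_im_ne_zero' : triZeta.im ≠ 0 := by
  rw [triZeta_im]; positivity

/-- `√2 · (δ / √2) = δ`. [folklore] -/
theorem sqrt_two_mul_div_sqrt_two (δ : ℝ) : Real.sqrt 2 * (δ / Real.sqrt 2) = δ :=
  mul_div_cancel₀ δ (Real.sqrt_ne_zero'.2 two_pos)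

/-- `(√2 · δ) / √2 = δ`. [folklore] -/
theorem sqrt_two_mul_div_sqrt_two' (δ : ℝ) : Real.sqrt 2 * δ / Real.sqrt 2 = δ :=
  mul_div_cancel_left₀ δ (Real.sqrt_ne_zero'.2 two_pos)

/-- **The dictionary in the triangular frame.** For `S = R'.map φ_ζ` and `𝕋`-mesh `δ`, the
square-frame crude probability `cornerCrossingProb 0 R' (δ/√2)` sits between the `𝕋`-frame crude
probabilities of `S` with slacks `δ` and `2δ`. -/
theorem dictionary (R' : ConformalRectangle) {δ : ℝ} (hδ : 0 < δ) :
    (triSitePercolation half).real (upTriangleConfig ⁻¹' openCrossing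
        {y : Site 2 | triMeshPoint δ y ∈ (R'.map (shearHomeomorph triZeta triZeta_im_ne_zero')).carrier}
        {u : Site 2 | infDist (triMeshPoint δ u) ((R'.map (shearHomeomorph triZeta triZeta_im_ne_zero')).arc 0) ≤ δ}
        {v : Site 2 | infDist (triMeshPoint δ v) ((R'.map (shearHomeomorph triZeta triZeta_im_ne_zero')).arc 2) ≤ δ})
      ≤ cornerCrossingProb 0 R' (δ / Real.sqrt 2) ∧
    cornerCrossingProb 0 R' (δ / Real.sqrt 2) ≤ (triSitePercolation half).real (upTriangleConfig ⁻¹' openCrossing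
        {y : Site 2 | triMeshPoint δ y ∈ (R'.map (shearHomeomorph triZeta triZeta_im_ne_zero')).carrier}
        {u : Site 2 | infDist (triMeshPoint δ u) ((R'.map (shearHomeomorph triZeta triZeta_im_ne_zero')).arc 0) ≤ 2 * δ}
        {v : Site 2 | infDist (triMeshPoint δ v) ((R'.map (shearHomeomorph triZeta triZeta_im_ne_zero')).arc 2) ≤ 2 * δ}) := by
  have h := stub_shearDictionary R' (δ / Real.sqrt 2) (div_pos hδ (Real.sqrt_pos.2 two_pos))
  rw [sqrt_two_mul_div_sqrt_two] at h
  simpa only [MarkedDomain.carrier_map, MarkedDomain.arc_map, coe_shearHomeomorph] using h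

/-- **Cardy's formula for the crude `M_0` event in the triangular frame**: for every conformal
rectangle `R'`, the rectangle `S = φ_ζ R'` has crossing limit `F` for the family
`δ ↦ cornerCrossingProb 0 R' (δ/√2)`. -/
theorem hasCrossingLimit_shear (R' : ConformalRectangle) :
    ConformalRectangle.HasCrossingLimit (R'.map (shearHomeomorph triZeta triZeta_im_ne_zero'))
      (fun δ => cornerCrossingProb 0 R' (δ / Real.sqrt 2))
      Literature.Probability.RandomPlanarGeometry.cardyFunction := by
  set S : ConformalRectangle := R'.map (shearHomeomorph triZeta triZeta_im_ne_zero') with hS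
  refine stub_squeeze stub_upperQuad S _ ?_ ?_
  · -- lower: `tri Q δ ≤ crude_𝕋(S, δ, slack δ) ≤ corner (δ/√2)`
    intro Q r m t hr hm ht hsep c1 c2 c3 c4
    obtain ⟨δ₀, hδ₀, hincl⟩ :=
      stub_lowerInclusion stub_bondRealisation S Q r m t hr hm ht hsep c1 c2 c3 c4
    refine ⟨δ₀, hδ₀, fun δ hδ hδδ₀ => ?_⟩
    rw [triDomainCrossingProb_eq_measureReal]
    exact (measureReal_mono (hincl δ hδ hδδ₀) (measure_ne_top _ _)).trans (dictionary R' hδ).1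
  · -- upper: `corner (δ/√2) ≤ crude_𝕋(S, δ, slack 2δ) ≤ tri N δ`
    intro N r m τ hr hm hτ hsep hb hc hd hf0 hf2
    obtain ⟨δ₀, hδ₀, hincl⟩ :=
      stub_upperInclusion stub_ownerExtraction S N r m τ hr hm hτ hsep hb hc hd hf0 hf2
    refine ⟨δ₀, hδ₀, fun δ hδ hδδ₀ => ?_⟩
    rw [triDomainCrossingProb_eq_measureReal]
    exact (dictionary R' hδ).2.trans (measureReal_mono (hincl δ hδ hδδ₀) (measure_ne_top _ _))

/-- `δ ↦ √2 δ` maps `δ → 0⁺` to `δ → 0⁺`. [folklore] -/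
theorem tendsto_sqrt_two_mul :
    Tendsto (fun δ : ℝ => Real.sqrt 2 * δ) (𝓝[>] 0) (𝓝[>] 0) := by
  refine tendsto_nhdsWithin_iff.2 ⟨?_, ?_⟩
  · have h : Tendsto (fun δ : ℝ => Real.sqrt 2 * δ) (𝓝 0) (𝓝 (Real.sqrt 2 * 0)) :=
      tendsto_id.const_mul _
    rw [mul_zero] at h
    exact h.mono_left nhdsWithin_le_nhds
  · filter_upwards [self_mem_nhdsWithin] with δ hδ
    exact mul_pos (Real.sqrt_pos.2 two_pos) hδ

/-- **The crux in Literature vocabulary**: for conformal rectangles `R`, `R'` with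
`R = φ_ζ R'` (carrier and marked points) and a uniformizing datum `(φ, x)` of `R`,
`cornerCrossingProb 0 R' δ → F(crossRatio x)` as `δ → 0⁺`. -/
theorem tendsto_cornerCrossingProb_zero (R R' : ConformalRectangle)
    (φ : ConformalEquiv UpperHalfPlane.upperHalfPlaneSet R.carrier) (x : Fin 4 → ℝ)
    (hcar : R.carrier = moduliShear triZeta '' R'.carrier)
    (hpt : ∀ i, R.pt i = moduliShear triZeta (R'.pt i)) (hφ : R.IsUniformizing φ x) :
    Tendsto (cornerCrossingProb 0 R') (𝓝[>] 0)
      (𝓝 (Literature.Probability.RandomPlanarGeometry.cardyFunction (crossRatio x))) := by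
  set S : ConformalRectangle := R'.map (shearHomeomorph triZeta triZeta_im_ne_zero') with hS
  -- the uniformizing datum of `R` is one of `S` (same carrier, same marked points)
  have hSc : S.carrier = id '' R.carrier := by
    rw [Set.image_id, hcar]; rfl
  have hSp : ∀ i, S.pt i = id (R.pt i) := fun i => by
    rw [id, hpt i]; rfl
  have hlim : R.HasCrossingLimit (fun δ => cornerCrossingProb 0 R' (δ / Real.sqrt 2))
      Literature.Probability.RandomPlanarGeometry.cardyFunction :=
    ConformalRectangle.HasCrossingLimit.of_image_data differentiableOn_id (injOn_id _)
      continuousOn_id hSc hSp (hasCrossingLimit_shear R')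
  have h := (hlim φ x hφ).comp tendsto_sqrt_two_mul
  refine h.congr fun δ => ?_
  simp only [Function.comp_apply, sqrt_two_mul_div_sqrt_two']

end Summit.CriticalPhenomena.CardyFormulaZ2.Cruxes.SmirnovBasePoint.ShearedSandwich

namespace Summit.CriticalPhenomena.CardyFormulaZ2.Theorems

open Summit.CriticalPhenomena.CardyFormulaZ2.Cruxes.SmirnovBasePoint.ShearedSandwich

/-- **`SmirnovBasePoint` (item stmt-CriticalPhenomena-5474)**: `CardyMod 0 triZeta` — the crude
`M_0` crossing probability of `R'` tends to `F(η(φ_ζ R'))`. The route's inlined `P 0 R' δ` is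
literally `cornerCrossingProb 0 R' δ` (`CornerPercolation.lean`), and the claim is
`tendsto_cornerCrossingProb_zero`. -/
theorem SmirnovBasePoint_of :
    Summit.CriticalPhenomena.CardyFormulaZ2.Theses.CardySelfDualSegment.SmirnovBasePoint := by
  intro R R' φ x hcar hpt hφ
  exact tendsto_cornerCrossingProb_zero R R' φ x hcar hpt hφ

end Summit.CriticalPhenomena.CardyFormulaZ2.Theorems
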